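import Mathlib

/-!
# B4 (4.22): the uniform bound `γ₀''⁻¹` for the face functional of the block Green's function

Companion-paper certificate (paper sub-cell B04 of the Bałaban audit cell) — a KERNEL CERTIFICATE
CLOSING A LOCATED ROUTINE GAP (the cell's GAPS.md objection G-B4-08), not summit progress — for

* [B4] T. Bałaban, *Regularity and decay of lattice Green's functions*, Commun. Math. Phys. **89**
  (1983) 571–597 — bib key `Balaban1983RegularityDecay`; §4, pp. 592–593 [PDF 22–23],
  formulas (4.19), (4.21), (4.22): the last step of the proof of (4.14), hence of Proposition 3.1′.

## The printed text (verbatim, [B4] pp. 592–593)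

p. 592, after (4.16): «where B(⟨x,x′⟩) denotes the set of all bonds of the η-lattice connecting
the block B^k(x) with the block B^k(x′), i.e. B(⟨x,x′⟩) = {b ⊂ T_η : b₋ ∈ B^k(x), b₊ ∈ B^k(x′)}.
Now we have to show that A₀ > 0, more exactly A₀ ≥ γ₀″, γ₀″ > 0, and γ₀″ depends on d and a
only.» … «Now it is sufficient to prove that 0 < A₀⁻¹ ≤ γ₀″⁻¹, and γ₀″⁻¹ depends on d and a
only.» … «Let us introduce the notation
  ⟨φ, Aφ⟩ = a_k|(Q_kφ)(x)|² + ⟨φ, (−Δ^{η,N}_Δ)φ⟩ + a_k|(Q_kφ)(x′)|² + ⟨φ, (−Δ^{η,N}_{Δ′})φ⟩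
     + Σ_{b∈B(⟨x,x′⟩)} η^d |(∂^η φ)(b) − Σ_{b′∈B(⟨x,x′⟩)} η^{d−1} (∂^η φ)(b′)|².          (4.19)»
… «and we get the formula for A₀⁻¹:
  A₀⁻¹ = η + ⟨f_{⟨x,x′⟩}, A⁻¹ f_{⟨x,x′⟩}⟩,                                                (4.21)
where f_{⟨x,x′⟩}(y) = Σ_{b∈B(⟨x,x′⟩)} η^{d−1} (δ^η(y − b₊) − δ^η(y − b₋)).
Of course both terms on the right side of (4.21) are ≥ 0, and η = L^{−k}, 0 < η < 1. We have to
estimate the second term. From (4.19) and the definition of f_{⟨x,x′⟩} it follows that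
  ⟨f_{⟨x,x′⟩}, A⁻¹ f_{⟨x,x′⟩}⟩ ≤ ⟨f_{⟨x,x′⟩}, G_k(Δ) f_{⟨x,x′⟩}⟩ + ⟨f_{⟨x,x′⟩}, G_k(Δ′) f_{⟨x,x′⟩}⟩
     = 2 Σ_{y,y′∈Δ₁} η^{2(d−1)} G_k(Δ; y, y′),                                            (4.22)
where Δ₁ is any face of the block Δ, e.g. Δ₁ = {y ∈ Δ : y₁ = x₁ + 1 − η}. Of course the
expression on the right side of (4.22) is a constant γ₀″⁻¹ depending on d and a only. Thus the
inequality (4.14) is proved and the proof of Proposition 3.1′ is completed.» (p. 593).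
Normalisations used ([B4] p. 572, (1.3)–(1.5)): `⟨φ, (−Δ^{η,N}_Ω)φ⟩ = Σ_{b⊂Ω} η^d |(∂^ηφ)(b)|²`
with `(∂^ηφ)(b) = η⁻¹(φ(b₊) − φ(b₋))` (at `A = 0`), `(Q_kφ)(y) = Σ_{x∈B^k(y)} η^d φ(x)`,
`P_k = Q_k^* Q_k`, `⟨φ,ψ⟩ = Σ_y η^d φ(y)ψ(y)`; `a_k` is «a constant proportional to a» (p. 573,
after (1.14)).

The cell's GAPS.md row G-B4-08 records the last «Of course» as an objection (gap-routine: one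
uniform bound unstated): the right side of (4.22) has to be bounded UNIFORMLY in `η = L^{−k}`,
`k = 1, 2, …`, and no argument is printed.  This file supplies the argument and its kernel check.

## Typing (exact and finite-dimensional; no carriers; the only hypothesis is `0 < a`)

* The block `Δ = B^k(x)` of the η-lattice is `Blk D n = (Fin D → Fin n)` with `n = η⁻¹ = L^k`
  points per direction (`D` = the paper's `d`).  Everything below holds for every `n ≥ 1` (not
  only powers of `L`) and every `D`.
* `qform a φ = a·(η^D Σ_y φ(y))² + η^{D−2} Σ_{b⊂Δ} (φ(b₊) − φ(b₋))²` (`mean`, `dirichlet`;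
  `η^{D−2} = n²/n^D`) is the one-block part `a_k|(Q_kφ)(x)|² + ⟨φ, (−Δ^{η,N}_Δ)φ⟩` of (4.19) in the
  normalisations above (`A` gauged to `0` in the block, as on p. 593 l. 1–3 of §5 and in (4.19)).
  The bonds `b ⊂ Δ` (Neumann boundary condition: only bonds with both ends in `Δ`) are enumerated as
  pairs `(μ, y)` through the clamped forward neighbour `nxt y μ`; pairs with `y_μ = n − 1` give `0`.
* `Mform D n a` is the matrix of this form in the standard coordinates of `ℝ^Δ`
  (`dotProduct_Mform_mulVec_self : φ ⬝ M φ = qform a φ`; symmetric and positive definite: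
  `Mform_isHermitian`, `Mform_posDef`, `Mform_isUnit_det`).  DICTIONARY: the block operator
  `A_Δ = a_k Q_k^*Q_k + (−Δ^{η,N}_Δ)` of (4.19)/(4.22) satisfies `⟨φ, A_Δ ψ⟩ = φ ⬝ M ψ`, i.e.
  `A_Δ = η^{−d} M` as a matrix, so `G_k(Δ) = A_Δ⁻¹ = η^d M⁻¹`; in the η-lattice kernel convention
  `(G f)(y) = Σ_{y′} η^d G(y, y′) f(y′)` (the one that makes `⟨f, G_k(Δ) f⟩` with
  `f|_Δ = −η⁻¹ 1_{Δ₁}` equal to the printed `Σ_{y,y′∈Δ₁} η^{2(d−1)} G_k(Δ; y, y′)`) this reads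
  `G_k(Δ; y, y′) = (M⁻¹)_{y y′}` EXACTLY (`Mform_mulVec_inv_mulVec`, `Mform_inv_isHermitian`).
  Hence `Σ_{y,y′∈Δ₁} η^{2(d−1)} G_k(Δ; y, y′) = v ⬝ M⁻¹ v` with `v = faceVec i c = η^{d−1} 1_{Δ₁}`
  (`faceVec_dotProduct_mulVec`).
* Faces: `layer i c = {y ∈ Δ : y_i = c}` — both faces normal to `e_i` (`c = 0`, `c = n − 1`; the
  printed example is `c = n − 1` for `i = 1`) and every parallel layer («Δ₁ is any face»).
* A mass term `m² ≥ 0` ([B4] (1.6)) does not occur in (4.19); adding `m²‖φ‖²` to the form would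
  only decrease `M⁻¹` in the sense used (the variational bound of §6 is monotone in the form).

## Result (the supplied proof, kernel-checked; all `[folklore]` linear algebra)

`ineq422` / `ineq422_eta`: for `0 < a`, all `n ≥ 1`, `D ≥ 1`, `i : Fin D`, `c : Fin n`,
  `η^{2(D−1)} Σ_{y,y′∈Δ₁} (M⁻¹)_{y y′} ≤ 2·max{1, a⁻¹}`,
so the right side of (4.22) is `≤ 4 max{1, a_k⁻¹}` and, with (4.21)–(4.22),
`A₀⁻¹ ≤ η + 4 max{1, a_k⁻¹} ≤ 1 + 4 max{1, a_k⁻¹} =: γ₀″⁻¹` (`gamma0_inv_le`) — a constant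
depending on `a_k` only.  The certificate is uniform in `d` as well (the print says «depending on d
and a»; `d`-independence is a by-product of the transverse invariance of the face functional).
Mechanism: (§3) the discrete trace inequality
  `(η^{D−1} Σ_{Δ₁} φ)² ≤ 2 (η^D Σ_Δ φ)² + 2 η^{D−2} Σ_{bonds normal to Δ₁} (φ(b₊) − φ(b₋))²
                      ≤ 2 max{1, a⁻¹} · qform a φ`                                  (`faceMean_sq_le`)
by telescoping along the lines normal to the face (`abs_sub_le_lineVar`), the fibre count
(`sum_update_eq`: each point of `Δ₁` has exactly `n` points of `Δ` above it) and Cauchy–Schwarz with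
`#(normal bonds) ≤ n^D`; (§4) positivity of the form (`dirichlet = 0 ⇒ φ constant`, coordinate-wise
interpolation `zz`); (§6) the variational bound `v ⬝ M⁻¹ v ≤ C` whenever `(v ⬝ φ)² ≤ C (φ ⬝ M φ)`
for all `φ` and `M` is invertible (`dotProduct_inv_mulVec_le`, with `φ = M⁻¹ v`).
(For orientation only, not used or certified: by the cosine eigenbasis of the Neumann block the exact
value is `a⁻¹ + (n−1)(2n−1)/(6n²) < a⁻¹ + 1/3`.)

NOT certified here (printed steps, read in prose by the cell): the Gaussian Fourier-transform
computation (4.16)–(4.21) and the inequality in (4.22) itself (`A ≥ A_Δ ⊕ A_{Δ′}` from (4.19), an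
operator monotonicity); this file certifies exactly the sentence «the expression on the right side
of (4.22) is a constant γ₀″⁻¹ depending on d and a only», with the explicit constant.
No `sorry`; imports `Mathlib` only.
-/

namespace Literature.MathematicalPhysics.QuantumFieldTheory.Balaban1983to89.B4Ineq422

open Finset

noncomputable section

variable {D n : ℕ}

/-! ## 1. The block, clamped coordinates, lines and telescoping -/

/-- the block `Δ ∩ ηℤ^d ≅ (Fin D → Fin n)`, `n = η⁻¹ = L^k`. [folklore] -/
abbrev Blk (D n : ℕ) := Fin D → Fin n

/-- clamped coordinate `min m (n-1)` as an element of `Fin n`. [folklore] -/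
def clampFin (n : ℕ) [NeZero n] (m : ℕ) : Fin n := ⟨min m (n - 1), by have := NeZero.pos n; omega⟩

/-- value of the clamped coordinate. [folklore] -/
@[simp] theorem clampFin_val [NeZero n] (m : ℕ) : (clampFin n m : ℕ) = min m (n - 1) := rfl

/-- below `n` the clamp is the identity. [folklore] -/
theorem clampFin_of_lt [NeZero n] {m : ℕ} (h : m < n) : clampFin n m = ⟨m, h⟩ := by
  ext; simp [clampFin]; omega

/-- clamping an element of `Fin n` returns it. [folklore] -/
@[simp] theorem clampFin_coe [NeZero n] (j : Fin n) : clampFin n (j : ℕ) = j := by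
  ext; simp [clampFin]; omega

/-- `clamp (clamp m + 1) = clamp (m + 1)`. [folklore] -/
theorem clampFin_succ_clamp [NeZero n] (m : ℕ) :
    clampFin n ((clampFin n m : ℕ) + 1) = clampFin n (m + 1) := by
  ext; simp [clampFin]; omega

/-- the forward neighbour of `y` in direction `μ` inside the block (`y` itself on the far face). [folklore] -/
def nxt [NeZero n] (y : Blk D n) (μ : Fin D) : Blk D n := Function.update y μ (clampFin n ((y μ : ℕ) + 1))

/-- the ℕ-parametrised line through `y` in direction `i`: `m ↦ g (y with y_i := min m (n-1))`. [folklore] -/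
def line [NeZero n] (g : Blk D n → ℝ) (i : Fin D) (y : Blk D n) (m : ℕ) : ℝ :=
  g (Function.update y i (clampFin n m))

/-- the line function at `j < n` is `g` at the point with `i`-th coordinate `j`. [folklore] -/
theorem line_coe [NeZero n] (g : Blk D n → ℝ) (i : Fin D) (y : Blk D n) (j : Fin n) :
    line g i y j = g (Function.update y i j) := by
  simp [line]

/-- the line through `y` passes through `y` at parameter `y_i`. [folklore] -/
theorem line_self [NeZero n] (g : Blk D n → ℝ) (i : Fin D) (y : Blk D n) :
    line g i y (y i) = g y := by
  simp [line]

/-- the forward neighbour of a point of the line is the next point of the line. [folklore] -/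
theorem nxt_update [NeZero n] (y : Blk D n) (i : Fin D) (j : Fin n) :
    nxt (Function.update y i j) i = Function.update y i (clampFin n ((j : ℕ) + 1)) := by
  simp [nxt, Function.update_idem]

/-- the line function depends on `y` only through the other coordinates. [folklore] -/
theorem line_update [NeZero n] (g : Blk D n → ℝ) (i : Fin D) (y : Blk D n) (v : Fin n) :
    line g i (Function.update y i v) = line g i y := by
  funext m; simp [line, Function.update_idem]

/-- telescoping on ℕ: `|ℓ p − ℓ q| ≤ Σ_{m<N} |ℓ(m+1) − ℓ m|` for `p, q ≤ N`. [folklore] -/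
theorem abs_sub_le_sum_range (ℓ : ℕ → ℝ) {p q N : ℕ} (hp : p ≤ N) (hq : q ≤ N) :
    |ℓ p - ℓ q| ≤ ∑ m ∈ range N, |ℓ (m + 1) - ℓ m| := by
  wlog hqp : q ≤ p generalizing p q
  · rw [abs_sub_comm]; exact this hq hp (le_of_not_ge hqp)
  have htel : ℓ p - ℓ q = ∑ m ∈ Ico q p, (ℓ (m + 1) - ℓ m) := by
    rw [Finset.sum_Ico_eq_sum_range]
    have h2 := Finset.sum_range_sub (fun k => ℓ (q + k)) (p - q)
    simp only [Nat.add_sub_cancel' hqp, add_zero] at h2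
    rw [← h2]
    simp only [add_assoc]
  rw [htel]
  refine (Finset.abs_sum_le_sum_abs _ _).trans ?_
  refine Finset.sum_le_sum_of_subset_of_nonneg ?_ (fun _ _ _ => abs_nonneg _)
  intro m hm
  simp only [Finset.mem_Ico] at hm
  simp only [Finset.mem_range]; omega

/-- the total variation of `g` along the line through `y` in direction `i`. [folklore] -/
def lineVar [NeZero n] (g : Blk D n → ℝ) (i : Fin D) (y : Blk D n) : ℝ :=
  ∑ j : Fin n, |g (nxt (Function.update y i j) i) - g (Function.update y i j)|

/-- the line variation as a `Finset.range` sum of the ℕ-parametrised line. [folklore] -/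
theorem lineVar_eq_sum_range [NeZero n] (g : Blk D n → ℝ) (i : Fin D) (y : Blk D n) :
    lineVar g i y = ∑ m ∈ range n, |line g i y (m + 1) - line g i y m| := by
  unfold lineVar
  have : ∀ j : Fin n, |g (nxt (Function.update y i j) i) - g (Function.update y i j)|
      = (fun m : ℕ => |line g i y (m + 1) - line g i y m|) (j : ℕ) := by
    intro j
    simp only [nxt_update, line, clampFin_coe]
  simp_rw [this]
  exact Fin.sum_univ_eq_sum_range (fun m => |line g i y (m + 1) - line g i y m|) n

/-- the line variation depends on `y` only through the other coordinates. [folklore] -/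
theorem lineVar_update [NeZero n] (g : Blk D n → ℝ) (i : Fin D) (y : Blk D n) (v : Fin n) :
    lineVar g i (Function.update y i v) = lineVar g i y := by
  simp [lineVar, Function.update_idem]

/-- the line estimate: `|g(y with y_i := c) − g(y)| ≤` the variation of `g` along that line. [folklore] -/
theorem abs_sub_le_lineVar [NeZero n] (g : Blk D n → ℝ) (i : Fin D) (y : Blk D n) (c : Fin n) :
    |g (Function.update y i c) - g y| ≤ lineVar g i y := by
  rw [lineVar_eq_sum_range, ← line_coe g i y c, ← line_self g i y]
  exact abs_sub_le_sum_range _ (Nat.le_of_lt c.isLt) (Nat.le_of_lt (y i).isLt)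


/-! ## 2. Layers, the fibre count and the block / face means -/

/-- the layer (face) `{y : y_i = c}` of the block. [folklore] -/
def layer (i : Fin D) (c : Fin n) : Finset (Blk D n) := univ.filter (fun y => y i = c)

/-- membership in a layer. [folklore] -/
theorem mem_layer {i : Fin D} {c : Fin n} {y : Blk D n} : y ∈ layer i c ↔ y i = c := by
  simp [layer]

/-- `layer × Fin n ≃ block`, `(y', j) ↦ (y' with y'_i := j)`. [folklore] -/
def layerEquiv (i : Fin D) (c : Fin n) : {y : Blk D n // y i = c} × Fin n ≃ Blk D n where
  toFun p := Function.update p.1.1 i p.2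
  invFun y := (⟨Function.update y i c, by simp⟩, y i)
  left_inv := by
    rintro ⟨⟨y', hy'⟩, j⟩
    refine Prod.ext (Subtype.ext ?_) ?_
    · simp only [Function.update_idem]
      conv_rhs => rw [← Function.update_eq_self i y']
      rw [hy']
    · simp
  right_inv y := by simp [Function.update_idem]

/-- reindexing the block sum along the lines normal to a layer. [folklore] -/
theorem sum_layer_sum (i : Fin D) (c : Fin n) (F : Blk D n → ℝ) :
    ∑ y' ∈ layer i c, ∑ j : Fin n, F (Function.update y' i j) = ∑ y, F y := by
  rw [layer, Finset.sum_subtype (univ.filter fun y : Blk D n => y i = c) (p := fun y => y i = c)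
    (by simp)]
  rw [← Equiv.sum_comp (layerEquiv i c) F, Fintype.sum_prod_type]
  rfl

/-- the fibre count: every point of the layer has exactly `n` preimages under the
projection `y ↦ (y with y_i := c)`. [folklore] -/
theorem sum_update_eq (i : Fin D) (c : Fin n) (h : Blk D n → ℝ) :
    ∑ y, h (Function.update y i c) = (n : ℝ) * ∑ y' ∈ layer i c, h y' := by
  rw [← sum_layer_sum i c (fun y => h (Function.update y i c))]
  simp only [Function.update_idem, Finset.sum_const, card_univ, Fintype.card_fin, nsmul_eq_mul]
  rw [Finset.mul_sum]
  refine Finset.sum_congr rfl (fun y' hy' => ?_)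
  rw [mem_layer] at hy'
  congr 1
  conv_rhs => rw [← Function.update_eq_self i y']
  rw [hy']

/-- the block mean `η^D Σ_y g(y)` (`η = 1/n`). [folklore] -/
def mean (g : Blk D n → ℝ) : ℝ := (∑ y, g y) / (n : ℝ) ^ D

/-- the face mean `η^{D-1} Σ_{y ∈ Δ₁} g(y) = (n / n^D) Σ_{y_i = c} g(y)`. [folklore] -/
def faceMean (i : Fin D) (c : Fin n) (g : Blk D n → ℝ) : ℝ :=
  (n : ℝ) * (∑ y ∈ layer i c, g y) / (n : ℝ) ^ D

/-- the Dirichlet form of the block with Neumann boundary conditions: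
`Σ_{bonds b ⊂ Δ} (g(b₊) − g(b₋))²`, written as a sum over `(μ, y)` (pairs with `y_μ = n − 1`
contribute `0`). [folklore] -/
def dirichlet [NeZero n] (g : Blk D n → ℝ) : ℝ := ∑ μ : Fin D, ∑ y, (g (nxt y μ) - g y) ^ 2

/-- the one-block quadratic form of B4 (4.19): `a (η^D Σ φ)² + η^{D-2} Σ_{b ⊂ Δ} (φ(b₊) − φ(b₋))²`,
`η^{D-2} = n² / n^D`. [cite: Balaban1983RegularityDecay, (4.19) p.592] -/
def qform [NeZero n] (a : ℝ) (g : Blk D n → ℝ) : ℝ :=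
  a * mean g ^ 2 + (n : ℝ) ^ 2 / (n : ℝ) ^ D * dirichlet g

/-- the Dirichlet form is nonnegative. [folklore] -/
theorem dirichlet_nonneg [NeZero n] (g : Blk D n → ℝ) : 0 ≤ dirichlet g := by
  unfold dirichlet; positivity

/-- the block form is nonnegative for `a ≥ 0`. [folklore] -/
theorem qform_nonneg [NeZero n] {a : ℝ} (ha : 0 ≤ a) (g : Blk D n → ℝ) : 0 ≤ qform a g := by
  have := dirichlet_nonneg g
  unfold qform; positivity

/-- the face mean as a block sum over the projection onto the layer. [folklore] -/
theorem faceMean_eq [NeZero n] (i : Fin D) (c : Fin n) (g : Blk D n → ℝ) :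
    faceMean i c g = (∑ y, g (Function.update y i c)) / (n : ℝ) ^ D := by
  rw [faceMean, sum_update_eq]

/-! ## 3. The discrete trace inequality -/

/-- `(face mean − block mean)² ≤ η^{D-2} Σ_{axis-i bonds} (Dg)²`. [folklore] -/
theorem faceMean_sub_mean_sq_le [NeZero n] (i : Fin D) (c : Fin n) (g : Blk D n → ℝ) :
    (faceMean i c g - mean g) ^ 2
      ≤ (n : ℝ) ^ 2 / (n : ℝ) ^ D * ∑ y, (g (nxt y i) - g y) ^ 2 := by
  have hn : (0 : ℝ) < n := by exact_mod_cast NeZero.pos n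
  have hnD : (0 : ℝ) < (n : ℝ) ^ D := by positivity
  set S := ∑ y, (g (Function.update y i c) - g y) with hS
  set T := ∑ y, |g (nxt y i) - g y| with hT
  set U := ∑ y, (g (nxt y i) - g y) ^ 2 with hU
  have h1 : faceMean i c g - mean g = S / (n : ℝ) ^ D := by
    rw [faceMean_eq, mean, hS, Finset.sum_sub_distrib, sub_div]
  have h2 : |S| ≤ (n : ℝ) * T := by
    calc |S| ≤ ∑ y, |g (Function.update y i c) - g y| := Finset.abs_sum_le_sum_abs _ _
      _ ≤ ∑ y, lineVar g i y := Finset.sum_le_sum (fun y _ => abs_sub_le_lineVar g i y c)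
      _ = ∑ y, lineVar g i (Function.update y i c) := by simp [lineVar_update]
      _ = (n : ℝ) * ∑ y' ∈ layer i c, lineVar g i y' := sum_update_eq i c (lineVar g i)
      _ = (n : ℝ) * T := by rw [hT, ← sum_layer_sum i c (fun y => |g (nxt y i) - g y|)]; rfl
  have h3 : T ^ 2 ≤ (n : ℝ) ^ D * U := by
    have hcs := Finset.sum_mul_sq_le_sq_mul_sq (univ : Finset (Blk D n)) (fun _ => (1 : ℝ))
      (fun y => |g (nxt y i) - g y|)
    have hcard : ((univ : Finset (Blk D n)).card : ℝ) = (n : ℝ) ^ D := by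
      rw [Finset.card_univ, Fintype.card_fun, Fintype.card_fin, Fintype.card_fin]; push_cast; rfl
    simpa [sq_abs, hcard, hT, hU] using hcs
  have hT0 : 0 ≤ T := by rw [hT]; positivity
  have h4 : S ^ 2 ≤ (n : ℝ) ^ 2 * ((n : ℝ) ^ D * U) := by
    have : |S| ^ 2 ≤ ((n : ℝ) * T) ^ 2 := pow_le_pow_left₀ (abs_nonneg S) h2 2
    rw [sq_abs] at this
    nlinarith
  rw [h1, div_pow]
  calc S ^ 2 / ((n : ℝ) ^ D) ^ 2 ≤ (n : ℝ) ^ 2 * ((n : ℝ) ^ D * U) / ((n : ℝ) ^ D) ^ 2 := by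
        gcongr
    _ = (n : ℝ) ^ 2 / (n : ℝ) ^ D * U := by field_simp

/-- THE TRACE INEQUALITY: `(face mean)² ≤ 2·max{1, a⁻¹} · qform a g`. [folklore] -/
theorem faceMean_sq_le [NeZero n] {a : ℝ} (ha : 0 < a) (i : Fin D) (c : Fin n)
    (g : Blk D n → ℝ) : faceMean i c g ^ 2 ≤ 2 * max 1 a⁻¹ * qform a g := by
  set K := max 1 a⁻¹ with hK
  have hK1 : 1 ≤ K := le_max_left _ _
  have hKa : a⁻¹ ≤ K := le_max_right _ _
  have hsub := faceMean_sub_mean_sq_le i c g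
  have hdir : ∑ y, (g (nxt y i) - g y) ^ 2 ≤ dirichlet g :=
    Finset.single_le_sum (f := fun μ => ∑ y, (g (nxt y μ) - g y) ^ 2)
      (fun μ _ => by positivity) (Finset.mem_univ i)
  have hsplit : faceMean i c g ^ 2 ≤ 2 * mean g ^ 2 + 2 * (faceMean i c g - mean g) ^ 2 := by
    nlinarith [sq_nonneg (mean g - (faceMean i c g - mean g))]
  have hm0 : 0 ≤ a * mean g ^ 2 := by positivity
  have e1 : 2 * mean g ^ 2 ≤ 2 * K * (a * mean g ^ 2) := by
    calc 2 * mean g ^ 2 = 2 * a⁻¹ * (a * mean g ^ 2) := by field_simp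
      _ ≤ 2 * K * (a * mean g ^ 2) := by gcongr
  have hco : 0 ≤ (n : ℝ) ^ 2 / (n : ℝ) ^ D := by positivity
  have hd : (n : ℝ) ^ 2 / (n : ℝ) ^ D * ∑ y, (g (nxt y i) - g y) ^ 2
      ≤ (n : ℝ) ^ 2 / (n : ℝ) ^ D * dirichlet g := by gcongr
  have hnn : 0 ≤ (n : ℝ) ^ 2 / (n : ℝ) ^ D * dirichlet g := mul_nonneg hco (dirichlet_nonneg g)
  have e2 : 2 * (faceMean i c g - mean g) ^ 2 ≤ 2 * K * ((n : ℝ) ^ 2 / (n : ℝ) ^ D * dirichlet g) := by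
    nlinarith
  unfold qform
  nlinarith


/-! ## 4. Positivity of the block form: zero Dirichlet form forces a constant -/

/-- zero forward differences ⇒ consecutive values of the line function agree. [folklore] -/
theorem line_succ_eq [NeZero n] {g : Blk D n → ℝ} (h : ∀ μ y, g (nxt y μ) = g y)
    (μ : Fin D) (y : Blk D n) (m : ℕ) : line g μ y (m + 1) = line g μ y m := by
  have := h μ (Function.update y μ (clampFin n m))
  rw [nxt_update, clampFin_succ_clamp] at this
  simpa [line] using this

/-- zero forward differences ⇒ the line function is constant. [folklore] -/
theorem line_const [NeZero n] {g : Blk D n → ℝ} (h : ∀ μ y, g (nxt y μ) = g y)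
    (μ : Fin D) (y : Blk D n) (m : ℕ) : line g μ y m = line g μ y 0 := by
  induction m with
  | zero => rfl
  | succ m ih => rw [line_succ_eq h, ih]

/-- zero forward differences ⇒ `g` does not depend on the `μ`-th coordinate. [folklore] -/
theorem update_irrel [NeZero n] {g : Blk D n → ℝ} (h : ∀ μ y, g (nxt y μ) = g y)
    (μ : Fin D) (y : Blk D n) (j j' : Fin n) :
    g (Function.update y μ j) = g (Function.update y μ j') := by
  rw [← line_coe g μ y j, ← line_coe g μ y j', line_const h, line_const h μ y (j' : ℕ)]

/-- coordinate-by-coordinate interpolation between two block points. [folklore] -/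
def zz (y y' : Blk D n) (m : ℕ) : Blk D n := fun ν => if (ν : ℕ) < m then y' ν else y ν

/-- the interpolation starts at `y`. [folklore] -/
theorem zz_zero (y y' : Blk D n) : zz y y' 0 = y := by
  funext ν; simp [zz]

/-- the interpolation ends at `y'`. [folklore] -/
theorem zz_top (y y' : Blk D n) : zz y y' D = y' := by
  funext ν; simp [zz, ν.isLt]

/-- one interpolation step changes one coordinate. [folklore] -/
theorem zz_succ_of_lt (y y' : Blk D n) {m : ℕ} (hm : m < D) :
    zz y y' (m + 1) = Function.update (zz y y' m) ⟨m, hm⟩ (y' ⟨m, hm⟩) := by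
  funext ν
  by_cases hν : ν = ⟨m, hm⟩
  · subst hν; simp [zz]
  · have hne : (ν : ℕ) ≠ m := fun e => hν (Fin.ext e)
    rw [Function.update_of_ne hν]
    have hiff : ((ν : ℕ) < m + 1) ↔ ((ν : ℕ) < m) := by omega
    simp only [zz, hiff]

/-- the interpolation is stationary after `D` steps. [folklore] -/
theorem zz_succ_of_le (y y' : Blk D n) {m : ℕ} (hm : D ≤ m) : zz y y' (m + 1) = zz y y' m := by
  funext ν
  have h1 : (ν : ℕ) < m := lt_of_lt_of_le ν.isLt hm
  have h2 : (ν : ℕ) < m + 1 := Nat.lt_succ_of_lt h1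
  simp [zz, h1, h2]

/-- zero forward differences in every direction ⇒ `g` is constant on the block. [folklore] -/
theorem const_of_nxt_eq [NeZero n] {g : Blk D n → ℝ} (h : ∀ μ y, g (nxt y μ) = g y)
    (y y' : Blk D n) : g y' = g y := by
  have key : ∀ m : ℕ, g (zz y y' m) = g y := by
    intro m
    induction m with
    | zero => rw [zz_zero]
    | succ m ih =>
      by_cases hm : m < D
      · rw [zz_succ_of_lt y y' hm]
        rw [update_irrel h ⟨m, hm⟩ (zz y y' m) (y' ⟨m, hm⟩) ((zz y y' m) ⟨m, hm⟩),
          Function.update_eq_self, ih]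
      · rw [zz_succ_of_le y y' (not_lt.mp hm), ih]
  simpa [zz_top] using key D

/-- zero Dirichlet form ⇒ all forward differences vanish. [folklore] -/
theorem dirichlet_eq_zero [NeZero n] {g : Blk D n → ℝ} (h : dirichlet g = 0) (μ : Fin D)
    (y : Blk D n) : g (nxt y μ) = g y := by
  unfold dirichlet at h
  have h1 : ∑ y, (g (nxt y μ) - g y) ^ 2 = 0 := by
    have := (Finset.sum_eq_zero_iff_of_nonneg (fun μ _ => by positivity)).mp h μ (mem_univ μ)
    simpa using this
  have h2 : (g (nxt y μ) - g y) ^ 2 = 0 :=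
    (Finset.sum_eq_zero_iff_of_nonneg (fun y _ => by positivity)).mp h1 y (mem_univ y)
  have := pow_eq_zero_iff (n := 2) (by norm_num) |>.mp h2
  linarith

/-- the mean of a constant. [folklore] -/
theorem mean_const [NeZero n] (t : ℝ) : mean (fun _ : Blk D n => t) = t := by
  have hn : (n : ℝ) ≠ 0 := by exact_mod_cast (NeZero.ne n)
  rw [mean, Finset.sum_const, card_univ, Fintype.card_fun, Fintype.card_fin, Fintype.card_fin,
    nsmul_eq_mul]
  push_cast
  field_simp

/-- the block form is positive definite for `a > 0`: `qform a g = 0 ⇒ g = 0`. [folklore] -/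
theorem eq_zero_of_qform_eq_zero [NeZero n] {a : ℝ} (ha : 0 < a) {g : Blk D n → ℝ}
    (h : qform a g = 0) : g = 0 := by
  have hn : (0 : ℝ) < n := by exact_mod_cast NeZero.pos n
  have hco : 0 < (n : ℝ) ^ 2 / (n : ℝ) ^ D := by positivity
  have hd0 := dirichlet_nonneg g
  have hm0 : 0 ≤ a * mean g ^ 2 := by positivity
  have hmean : mean g = 0 := by
    unfold qform at h
    have : a * mean g ^ 2 = 0 := by nlinarith
    rcases mul_eq_zero.mp this with h' | h'
    · exact absurd h' ha.ne'
    · exact pow_eq_zero_iff (n := 2) (by norm_num) |>.mp h'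
  have hdir : dirichlet g = 0 := by
    unfold qform at h
    have : (n : ℝ) ^ 2 / (n : ℝ) ^ D * dirichlet g = 0 := by nlinarith
    rcases mul_eq_zero.mp this with h' | h'
    · exact absurd h' hco.ne'
    · exact h'
  have hconst := const_of_nxt_eq (dirichlet_eq_zero hdir)
  funext y₀
  have hg : g = fun _ => g y₀ := funext (fun y => hconst y₀ y)
  have : mean g = g y₀ := by rw [hg, mean_const]
  rw [← this, hmean]; rfl

/-! ## 5. The matrix of the block form and the Green's function `G_k(Δ; y, y') = (M⁻¹)_{y y'}` -/

open Matrix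

/-- weight vector of the block mean: `w₀ ⬝ g = mean g`. [folklore] -/
def w0 (D n : ℕ) : Blk D n → ℝ := fun _ => ((n : ℝ) ^ D)⁻¹

/-- weight vector of the bond `(μ, y)`: `w_b ⬝ g = g(nxt y μ) − g(y)`. [folklore] -/
def wb [NeZero n] (b : Fin D × Blk D n) : Blk D n → ℝ :=
  Pi.single (nxt b.2 b.1) 1 - Pi.single b.2 1

/-- `w₀ ⬝ g = mean g`. [folklore] -/
theorem w0_dotProduct (g : Blk D n → ℝ) : w0 D n ⬝ᵥ g = mean g := by
  simp only [w0, dotProduct, mean, ← Finset.mul_sum]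
  rw [inv_mul_eq_div]

/-- `w_b ⬝ g` is the bond difference. [folklore] -/
theorem wb_dotProduct [NeZero n] (b : Fin D × Blk D n) (g : Blk D n → ℝ) :
    wb b ⬝ᵥ g = g (nxt b.2 b.1) - g b.2 := by
  simp [wb, sub_dotProduct]

/-- the sum of squared bond differences is the Dirichlet form. [folklore] -/
theorem sum_wb_dotProduct_sq [NeZero n] (g : Blk D n → ℝ) :
    ∑ b : Fin D × Blk D n, (wb b ⬝ᵥ g) ^ 2 = dirichlet g := by
  simp only [wb_dotProduct, dirichlet, Fintype.sum_prod_type]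

/-- THE MATRIX of the one-block form (4.19) in the standard coordinates of `ℝ^Δ`:
`M_{y y'} = a η^{2D} + η^{D-2} (graph Laplacian of the block)_{y y'}`, written as a sum of rank-one
terms.  Its inverse is the block Green's function `G_k(Δ; y, y')` of B4 §4 in the kernel convention
`(G f)(y) = Σ_{y'} η^D G(y, y') f(y')`. [cite: Balaban1983RegularityDecay, (4.19)/(4.22) p.592-593] -/
def Mform (D n : ℕ) [NeZero n] (a : ℝ) : Matrix (Blk D n) (Blk D n) ℝ :=
  Matrix.of fun y y' => a * (w0 D n y * w0 D n y')
    + (n : ℝ) ^ 2 / (n : ℝ) ^ D * ∑ b : Fin D × Blk D n, wb b y * wb b y'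

/-- entries of the form matrix. [folklore] -/
theorem Mform_apply [NeZero n] (a : ℝ) (y y' : Blk D n) :
    Mform D n a y y' = a * (w0 D n y * w0 D n y')
      + (n : ℝ) ^ 2 / (n : ℝ) ^ D * ∑ b : Fin D × Blk D n, wb b y * wb b y' := rfl

/-- generic bilinear-form identity for a rank-one-sum matrix. [folklore] -/
theorem dotProduct_mulVec_rankOne {ι κ : Type*} [Fintype ι] [Fintype κ] (a c : ℝ)
    (u : ι → ℝ) (w : κ → ι → ℝ) (M : Matrix ι ι ℝ)
    (hM : ∀ y y', M y y' = a * (u y * u y') + c * ∑ b, w b y * w b y') (x x' : ι → ℝ) :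
    x ⬝ᵥ M.mulVec x' = a * ((u ⬝ᵥ x) * (u ⬝ᵥ x')) + c * ∑ b, (w b ⬝ᵥ x) * (w b ⬝ᵥ x') := by
  obtain ⟨W, hW⟩ : ∃ W : κ → ℝ, ∀ b, w b ⬝ᵥ x' = W b := ⟨_, fun b => rfl⟩
  obtain ⟨S, hS⟩ : ∃ S : ℝ, u ⬝ᵥ x' = S := ⟨_, rfl⟩
  have e1 : M.mulVec x' = fun y => a * S * u y + c * ∑ b, W b * w b y := by
    funext y
    rw [← hS]
    simp only [← hW]
    simp only [Matrix.mulVec, dotProduct, hM, add_mul, Finset.sum_add_distrib, Finset.sum_mul,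
      Finset.mul_sum]
    congr 1
    · exact Finset.sum_congr rfl (fun y' _ => by ring)
    · rw [Finset.sum_comm]
      exact Finset.sum_congr rfl (fun b _ => Finset.sum_congr rfl (fun y' _ => by ring))
  rw [hS]
  simp only [hW]
  rw [e1]
  simp only [dotProduct]
  simp only [mul_add, Finset.sum_add_distrib, Finset.mul_sum, Finset.sum_mul]
  congr 1
  · exact Finset.sum_congr rfl (fun y _ => by ring)
  · rw [Finset.sum_comm]
    exact Finset.sum_congr rfl (fun b _ => Finset.sum_congr rfl (fun y _ => by ring))

/-- the matrix represents the block form: `g ⬝ M g' ` is the polarisation of `qform`. [folklore] -/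
theorem dotProduct_Mform_mulVec [NeZero n] (a : ℝ) (x x' : Blk D n → ℝ) :
    x ⬝ᵥ (Mform D n a).mulVec x'
      = a * (mean x * mean x') + (n : ℝ) ^ 2 / (n : ℝ) ^ D
          * ∑ b : Fin D × Blk D n, (wb b ⬝ᵥ x) * (wb b ⬝ᵥ x') := by
  rw [dotProduct_mulVec_rankOne a _ (w0 D n) wb (Mform D n a) (fun y y' => rfl) x x',
    w0_dotProduct, w0_dotProduct]

/-- the matrix represents the block form: `x ⬝ M x = qform a x` (= the one-block part of B4 (4.19)). [cite: Balaban1983RegularityDecay, (4.19) p.592] -/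
theorem dotProduct_Mform_mulVec_self [NeZero n] (a : ℝ) (x : Blk D n → ℝ) :
    x ⬝ᵥ (Mform D n a).mulVec x = qform a x := by
  rw [dotProduct_Mform_mulVec, qform, ← sum_wb_dotProduct_sq, ← sq,
    show (∑ b : Fin D × Blk D n, (wb b ⬝ᵥ x) * (wb b ⬝ᵥ x)) = ∑ b, (wb b ⬝ᵥ x) ^ 2 from
      Finset.sum_congr rfl (fun b _ => (sq _).symm)]

/-- the form matrix is symmetric. [folklore] -/
theorem Mform_symm [NeZero n] (a : ℝ) (y y' : Blk D n) : Mform D n a y y' = Mform D n a y' y := by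
  rw [Mform_apply, Mform_apply, mul_comm (w0 D n y) (w0 D n y'),
    show (∑ b : Fin D × Blk D n, wb b y * wb b y') = ∑ b, wb b y' * wb b y from
      Finset.sum_congr rfl (fun b _ => mul_comm _ _)]

/-- the form matrix is Hermitian (real symmetric). [folklore] -/
theorem Mform_isHermitian [NeZero n] (a : ℝ) : (Mform D n a).IsHermitian :=
  Matrix.IsHermitian.ext (fun y y' => by simpa using Mform_symm a y' y)

/-- strict positivity of the form on `x ≠ 0`. [folklore] -/
theorem Mform_pos [NeZero n] {a : ℝ} (ha : 0 < a) {x : Blk D n → ℝ} (hx : x ≠ 0) :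
    0 < x ⬝ᵥ (Mform D n a).mulVec x := by
  rw [dotProduct_Mform_mulVec_self]
  rcases (qform_nonneg ha.le x).lt_or_eq with h | h
  · exact h
  · exact absurd (eq_zero_of_qform_eq_zero ha h.symm) hx

/-- the form matrix is positive definite for `a > 0`. [folklore] -/
theorem Mform_posDef [NeZero n] {a : ℝ} (ha : 0 < a) : (Mform D n a).PosDef :=
  Matrix.PosDef.of_dotProduct_mulVec_pos (Mform_isHermitian a)
    (fun x hx => by simpa using Mform_pos ha hx)

/-- the form matrix has trivial kernel for `a > 0`. [folklore] -/
theorem Mform_mulVec_injective [NeZero n] {a : ℝ} (ha : 0 < a) :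
    Function.Injective (Mform D n a).mulVec := by
  intro x x' hxx'
  by_contra hne
  have hsub : x - x' ≠ 0 := sub_ne_zero.mpr hne
  have hpos := Mform_pos ha hsub
  rw [Matrix.mulVec_sub, hxx', sub_self, dotProduct_zero] at hpos
  exact lt_irrefl _ hpos

/-- the form matrix is invertible for `a > 0` (so the block Green's function `G_k(Δ) = M⁻¹` exists). [folklore] -/
theorem Mform_isUnit_det [NeZero n] {a : ℝ} (ha : 0 < a) : IsUnit (Mform D n a).det := by
  rw [← Matrix.isUnit_iff_isUnit_det]
  exact (Matrix.mulVec_injective_iff_isUnit).mp (Mform_mulVec_injective ha)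

/-! ## 6. The variational bound for the inverse and the estimate of (4.22) -/

/-- variational bound: if `(v ⬝ g)² ≤ C (g ⬝ M g)` for all `g` and `M` is invertible, then
`v ⬝ M⁻¹ v ≤ C`. [folklore] -/
theorem dotProduct_inv_mulVec_le {ι : Type*} [Fintype ι] [DecidableEq ι] {M : Matrix ι ι ℝ}
    (hM : IsUnit M.det) (v : ι → ℝ) {C : ℝ} (hC : 0 ≤ C)
    (h : ∀ g : ι → ℝ, (v ⬝ᵥ g) ^ 2 ≤ C * (g ⬝ᵥ M.mulVec g)) :
    v ⬝ᵥ M⁻¹.mulVec v ≤ C := by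
  set g := M⁻¹.mulVec v with hg
  have hMg : M.mulVec g = v := by
    rw [hg, Matrix.mulVec_mulVec, Matrix.mul_nonsing_inv _ hM, Matrix.one_mulVec]
  have hq : g ⬝ᵥ M.mulVec g = v ⬝ᵥ g := by rw [hMg, dotProduct_comm]
  have hh := h g
  rw [hq] at hh
  by_cases ht : 0 < v ⬝ᵥ g
  · nlinarith
  · linarith

/-- the face vector `v = η^{D-1} 1_{Δ₁}`: `v ⬝ g = faceMean`. [folklore] -/
def faceVec (i : Fin D) (c : Fin n) : Blk D n → ℝ :=
  fun y => if y i = c then (n : ℝ) / (n : ℝ) ^ D else 0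

/-- `faceVec ⬝ g = faceMean g`. [folklore] -/
theorem faceVec_dotProduct (i : Fin D) (c : Fin n) (g : Blk D n → ℝ) :
    faceVec i c ⬝ᵥ g = faceMean i c g := by
  simp only [faceVec, dotProduct, faceMean, layer, ite_mul, zero_mul, Finset.sum_ite,
    Finset.sum_const_zero, add_zero, ← Finset.mul_sum]
  ring

/-- a matrix applied to the face vector. [folklore] -/
theorem mulVec_faceVec (i : Fin D) (c : Fin n) (N : Matrix (Blk D n) (Blk D n) ℝ) (y : Blk D n) :
    N.mulVec (faceVec i c) y = (n : ℝ) / (n : ℝ) ^ D * ∑ y' ∈ layer i c, N y y' := by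
  simp only [Matrix.mulVec, dotProduct, faceVec, mul_ite, mul_zero]
  rw [← Finset.sum_filter, Finset.mul_sum]
  exact Finset.sum_congr rfl (fun y' _ => by ring)

/-- `v ⬝ N v = η^{2(D-1)} Σ_{y,y' ∈ Δ₁} N_{y y'}` for the face vector `v` — the shape of the right side of B4 (4.22). [cite: Balaban1983RegularityDecay, (4.22) p.593] -/
theorem faceVec_dotProduct_mulVec (i : Fin D) (c : Fin n) (N : Matrix (Blk D n) (Blk D n) ℝ) :
    faceVec i c ⬝ᵥ N.mulVec (faceVec i c)
      = ((n : ℝ) / (n : ℝ) ^ D) ^ 2 * ∑ y ∈ layer i c, ∑ y' ∈ layer i c, N y y' := by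
  have e : faceVec i c ⬝ᵥ N.mulVec (faceVec i c)
      = ∑ y, if y i = c then (n : ℝ) / (n : ℝ) ^ D * ((n : ℝ) / (n : ℝ) ^ D
          * ∑ y' ∈ layer i c, N y y') else 0 := by
    simp only [dotProduct, mulVec_faceVec]
    exact Finset.sum_congr rfl (fun y _ => by unfold faceVec; split_ifs <;> simp)
  rw [e, ← Finset.sum_filter, Finset.mul_sum]
  exact Finset.sum_congr rfl (fun y _ => by ring)

/-- B4 (4.22), the unstated uniform bound («Of course the expression on the right side of (4.22) is
a constant γ₀''⁻¹ depending on d and a only»): for every face `Δ₁ = {y_i = c}` of the block,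
`η^{2(D-1)} Σ_{y, y' ∈ Δ₁} G_k(Δ; y, y') ≤ 2 max{1, a⁻¹}` — uniformly in `η = 1/n` and in `D`.
[cite: Balaban1983RegularityDecay, (4.22) p.593] -/
theorem ineq422 [NeZero n] {a : ℝ} (ha : 0 < a) (i : Fin D) (c : Fin n) :
    ((n : ℝ) / (n : ℝ) ^ D) ^ 2 * ∑ y ∈ layer i c, ∑ y' ∈ layer i c, (Mform D n a)⁻¹ y y'
      ≤ 2 * max 1 a⁻¹ := by
  rw [← faceVec_dotProduct_mulVec]
  refine dotProduct_inv_mulVec_le (Mform_isUnit_det ha) (faceVec i c) (by positivity) ?_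
  intro g
  rw [faceVec_dotProduct, dotProduct_Mform_mulVec_self]
  exact faceMean_sq_le ha i c g


/-! ## 7. The Green's function dictionary and the literal forms of (4.22) / γ₀'' -/

/-- `G_k(Δ) = M⁻¹` is the Green's function of the block form: `M (M⁻¹ f) = f`. [folklore] -/
theorem Mform_mulVec_inv_mulVec [NeZero n] {a : ℝ} (ha : 0 < a) (f : Blk D n → ℝ) :
    (Mform D n a).mulVec ((Mform D n a)⁻¹.mulVec f) = f := by
  rw [Matrix.mulVec_mulVec, Matrix.mul_nonsing_inv _ (Mform_isUnit_det ha), Matrix.one_mulVec]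

/-- … and `M⁻¹ (M g) = g`. [folklore] -/
theorem Mform_inv_mulVec_mulVec [NeZero n] {a : ℝ} (ha : 0 < a) (g : Blk D n → ℝ) :
    (Mform D n a)⁻¹.mulVec ((Mform D n a).mulVec g) = g := by
  rw [Matrix.mulVec_mulVec, Matrix.nonsing_inv_mul _ (Mform_isUnit_det ha), Matrix.one_mulVec]

/-- the Green's function is symmetric: `G_k(Δ; y, y') = G_k(Δ; y', y)`. [folklore] -/
theorem Mform_inv_isHermitian [NeZero n] (a : ℝ) : ((Mform D n a)⁻¹).IsHermitian :=
  (Mform_isHermitian a).inv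

/-- `η^{2(D-1)} = (n / n^D)²` for `η = 1/n` and `D ≥ 1`. [folklore] -/
theorem eta_pow_eq [NeZero n] (hD : 1 ≤ D) :
    ((1 : ℝ) / n) ^ (2 * (D - 1)) = ((n : ℝ) / (n : ℝ) ^ D) ^ 2 := by
  have hn : (n : ℝ) ≠ 0 := by exact_mod_cast NeZero.ne n
  obtain ⟨D', rfl⟩ : ∃ D', D = D' + 1 := ⟨D - 1, by omega⟩
  rw [Nat.add_sub_cancel, div_pow, one_pow, div_pow, pow_succ]
  field_simp
  ring

/-- B4 (4.22) in the paper's letters: `η^{2(d-1)} Σ_{y,y' ∈ Δ₁} G_k(Δ; y, y') ≤ 2 max{1, a_k⁻¹}`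
for every face `Δ₁` of the block `Δ`, every `η = 1/n` and every dimension `d = D ≥ 1`
(«the expression on the right side of (4.22) is a constant γ₀''⁻¹ depending on d and a only» — here
with the explicit, `d`-independent constant). [cite: Balaban1983RegularityDecay, (4.22) p.593] -/
theorem ineq422_eta [NeZero n] {a : ℝ} (ha : 0 < a) (i : Fin D) (c : Fin n) :
    ((1 : ℝ) / n) ^ (2 * (D - 1)) * ∑ y ∈ layer i c, ∑ y' ∈ layer i c, (Mform D n a)⁻¹ y y'
      ≤ 2 * max 1 a⁻¹ := by
  rw [eta_pow_eq (Nat.succ_le_of_lt (Fin.pos i))]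
  exact ineq422 ha i c

/-- the constant `γ₀''`: with (4.21) `A₀⁻¹ = η + ⟨f, A⁻¹ f⟩` and (4.22)
`⟨f, A⁻¹ f⟩ ≤ 2 Σ_{y,y'∈Δ₁} η^{2(d-1)} G_k(Δ; y, y')` (both printed; taken here as hypotheses on the
three real numbers involved), `A₀⁻¹ ≤ 1 + 4 max{1, a_k⁻¹} =: γ₀''⁻¹`, uniformly in `η = L^{-k} ≤ 1`
and in `d`. [cite: Balaban1983RegularityDecay, (4.21)-(4.22) p.592-593] -/
theorem gamma0_inv_le [NeZero n] {a : ℝ} (ha : 0 < a) (i : Fin D) (c : Fin n) {A0inv fAf : ℝ}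
    (h421 : A0inv = (1 : ℝ) / n + fAf)
    (h422 : fAf ≤ 2 * (((1 : ℝ) / n) ^ (2 * (D - 1))
      * ∑ y ∈ layer i c, ∑ y' ∈ layer i c, (Mform D n a)⁻¹ y y')) :
    A0inv ≤ 1 + 4 * max 1 a⁻¹ := by
  have h1 : (1 : ℝ) / n ≤ 1 := by
    rw [div_le_one (by exact_mod_cast NeZero.pos n)]
    exact_mod_cast NeZero.one_le
  have h2 := ineq422_eta ha i c
  rw [h421]
  linarith

end

end Literature.MathematicalPhysics.QuantumFieldTheory.Balaban1983to89.B4Ineq422
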